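import Summits.SmoothPoincare4.SmoothPoincare4.Theses.EntropyRung
import Summits.SmoothPoincare4.SmoothPoincare4.Theorems.EntropyRungSubcylindricalExistenceFloorBridgeGauge
import Summits.SmoothPoincare4.SmoothPoincare4.Theorems.EntropyRungSubcylindricalExistenceEntropyVolume
import Literature.Geometry.Lorentzian.CurvatureSymmetries
import Literature.Geometry.Lorentzian.MassCapacityHarmonic
import Literature.Geometry.Riemannian.BakryEmeryHeatFlow
import Literature.Geometry.Riemannian.CanonicalNeighbourhoodScaling
import HarnessLib

/-!
# The floor bridge of line `fat-conical-core-avr-logsobolev` (stub `stub_floorBridge`, crux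
`EntropyRung.SubcylindricalExistence`, stmt-SmoothPoincare4-10871)

BKT's sharp log-Sobolev inequality on the complete `Ric ≥ 0` core `(P, h) = ({p}ᶜ, Λ²g)` of
asymptotic volume ratio `c³` (a HYPOTHESIS of the stub, in scale-family form: Balogh–Kristály–Tripaldi,
J. Funct. Anal. 286 (2024), Thm. 1.1, `p = 2`, `N = 4`) is transported along the identification
`ι : P → M ∖ {p}` to the floor
`3 log c ≤ ∫ (4τΛ⁻²|∇w|²_g − w² log w² − 4w²)(4πτ)⁻²Λ⁴ dV_g` for smooth `w` vanishing near `p`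
with `∫ (4πτ)⁻² w² Λ⁴ dV_g = 1`, and `Ric_h ≥ 0` is transported to `R_g Λ − 6Δ_g Λ ≥ 0` off `p`.

`Λ` is frozen to a global smooth positive factor `Φ` (`Φ = Λ` on an open `U ⊇ tsupport w`,
`p ∉ U`, by a smooth Urysohn function, `exists_gauge`); the transport of integrals, of `|∇·|²`
and of `R` along `ι` for the frozen gauge is the landed helper `helper_stub_floorBridge_gauge`
(`EntropyRungSubcylindricalExistenceFloorBridgeGauge.lean`). The scale algebra
`log Y = min_λ (λY − 1 − log λ)` is the substitution `u = (4πτ)⁻¹ w ∘ ι`: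
`∫ u² = 1`, `∫ u² log u² = log A + A ∫ w² log w² Λ⁴`, `∫ |∇u|²_h = A ∫ Λ⁻²|∇w|²_g Λ⁴`,
`A = (4πτ)⁻²`, `log A = −2 log(4πτ)`. Everything is proved; no definition, no named fact.

References: B. O'Neill, *Semi-Riemannian geometry* (1983), Ch. 3, pp. 90–91, Prop. 3.59
[ONeill1983]; H. Federer, *Geometric Measure Theory* (1969), §2.10.11, §3.2.46 [Federer1969].
-/

noncomputable section

open scoped Manifold ContDiff Topology ENNReal NNReal
open Bundle Topology Set Filter Function MeasureTheory Measure
open Literature.Geometry.Lorentzian Literature.Geometry.Riemannian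

set_option linter.dupNamespace false

namespace Summit.SmoothPoincare4.SmoothPoincare4.Theorems

namespace StubFloorBridgeAux

open Literature.Geometry.Lorentzian.PseudoRiemannianMetric

/-! ## Compact support of the transported test function; the frozen conformal factor -/

section Gauge

variable {M : Type} [TopologicalSpace M] [T2Space M] [ChartedSpace (EuclideanSpace ℝ (Fin 4)) M]
  [IsManifold (𝓡 4) ∞ M] [CompactSpace M] {P : Type} [TopologicalSpace P]

omit [T2Space M] [IsManifold (𝓡 4) ∞ M] [ChartedSpace (EuclideanSpace ℝ (Fin 4)) M] in
/-- A function vanishing near `p` has compactly supported pullback along `ι : P → M ∖ {p}`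
(`ι⁻¹(tsupport w) = σ(tsupport w)` is compact). [folklore] -/
theorem hasCompactSupport_comp {w : M → ℝ} {ι : P → M} {σ : M → P} {p : M}
    (hw : w =ᶠ[𝓝 p] 0) (hιc : Continuous ι)
    (hσ : ContinuousOn σ {p}ᶜ) (hσι : ∀ q, σ (ι q) = q) (hισ : ∀ x, x ≠ p → ι (σ x) = x) :
    HasCompactSupport (fun q ↦ w (ι q)) := by
  have hK : IsCompact (tsupport w) := (isClosed_tsupport w).isCompact
  have hpK : p ∉ tsupport w := notMem_tsupport_iff_eventuallyEq.2 hw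
  have hKsub : tsupport w ⊆ {p}ᶜ := fun x hx hxp ↦ hpK (mem_singleton_iff.1 hxp ▸ hx)
  have himage : ι ⁻¹' tsupport w = σ '' tsupport w := by
    ext q
    constructor
    · intro hq
      exact ⟨ι q, hq, hσι q⟩
    · rintro ⟨x, hx, rfl⟩
      change ι (σ x) ∈ tsupport w
      rw [hισ x (hKsub hx)]
      exact hx
  have hc : IsCompact (ι ⁻¹' tsupport w) := by
    rw [himage]
    exact hK.image_of_continuousOn (hσ.mono hKsub)
  refine IsCompact.of_isClosed_subset hc (isClosed_tsupport _) ?_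
  exact closure_minimal (fun q hq ↦ subset_tsupport w hq) ((isClosed_tsupport w).preimage hιc)

/-- **The frozen conformal factor.** For `Λ` smooth and positive on `{p}ᶜ` and a closed `K ∌ p`
there is a smooth positive `Φ` on `M` with `Φ = Λ` on an open `U ⊇ K`, `p ∉ U`
(`Φ = χΛ + (1 − χ)` for a smooth Urysohn function `χ`, `χ = 0` near `p`, `χ = 1` near `K`).
[folklore] -/
theorem exists_gauge {p : M} {Λ : M → ℝ} (hΛs : ContMDiffOn (𝓡 4) 𝓘(ℝ, ℝ) ∞ Λ {p}ᶜ)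
    (hΛpos : ∀ x, x ≠ p → 0 < Λ x) {K : Set M} (hK : IsClosed K) (hpK : p ∉ K) :
    ∃ Φ : M → ℝ, ContMDiff (𝓡 4) 𝓘(ℝ, ℝ) ∞ Φ ∧ (∀ x, 0 < Φ x) ∧
      ∃ U : Set M, IsOpen U ∧ K ⊆ U ∧ p ∉ U ∧ ∀ x ∈ U, Φ x = Λ x := by
  obtain ⟨χ, hχ0, hχ1, hχ01⟩ := exists_contMDiffMap_zero_one_nhds_of_isClosed (𝓡 4) (n := ⊤)
    isClosed_singleton hK (disjoint_singleton_left.2 hpK)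
  rw [nhdsSet_singleton] at hχ0
  have hχp : χ p = 0 := hχ0.self_of_nhds
  refine ⟨fun x ↦ χ x * Λ x + (1 - χ x), ?_, ?_, ?_⟩
  · intro x
    by_cases hx : x = p
    · subst hx
      have hev : (fun y ↦ χ y * Λ y + (1 - χ y)) =ᶠ[𝓝 x] fun _ ↦ (1 : ℝ) := by
        filter_upwards [hχ0] with y hy
        simp [hy]
      exact contMDiffAt_const.congr_of_eventuallyEq hev
    · have hΛx : ContMDiffAt (𝓡 4) 𝓘(ℝ, ℝ) ∞ Λ x :=
        hΛs.contMDiffAt (isOpen_compl_singleton.mem_nhds hx)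
      have hχx : ContMDiffAt (𝓡 4) 𝓘(ℝ, ℝ) ∞ χ x := χ.contMDiff x
      exact (hχx.mul hΛx).add (contMDiffAt_const.sub hχx)
  · intro x
    change 0 < χ x * Λ x + (1 - χ x)
    have h01 := hχ01 x
    by_cases hx : x = p
    · subst hx
      simp [hχp]
    · have hΛ := hΛpos x hx
      have h1 : 0 ≤ 1 - χ x := sub_nonneg.2 h01.2
      rcases h01.1.eq_or_lt with h0 | h0
      · rw [← h0]
        norm_num
      · positivity
  · obtain ⟨U, hUo, hKU, hU1⟩ := mem_nhdsSet_iff_exists.1 hχ1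
    refine ⟨U, hUo, hKU, fun hpU ↦ ?_, fun x hx ↦ ?_⟩
    · have h1 : χ p = 1 := hU1 hpU
      exact one_ne_zero (h1.symm.trans hχp)
    · have h1 : χ x = 1 := hU1 hx
      simp [h1]

end Gauge

end StubFloorBridgeAux

open StubFloorBridgeAux

/-- **Stub F · the floor bridge** (registered stub `stub_floorBridge` of line
`fat-conical-core-avr-logsobolev`, crux `EntropyRung.SubcylindricalExistence`): for a closed smooth
4-manifold `M` with a Riemannian `g` (Levi-Civita), a point `p`, a conformal factor `Λ` smooth and
positive on `{p}ᶜ`, and a complete `Ric ≥ 0` core `(P, h)` of asymptotic volume ratio `c³`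
identified with `({p}ᶜ, Λ²g)` by the inverse pair `(ι, σ)`, the Balogh–Kristály–Tripaldi
log-Sobolev inequality on `(P, h)` (hypothesis, scale-family form of J. Funct. Anal. 286 (2024),
Thm. 1.1, `p = 2`, `N = 4`) yields the scale-uniform floor
`3 log c ≤ ∫ (4τΛ⁻²|∇w|²_g − w² log w² − 4w²)(4πτ)⁻²Λ⁴ dV_g` for smooth `w` vanishing near `p` with
`∫ (4πτ)⁻² w² Λ⁴ dV_g = 1` (transport of `u = (4πτ)⁻¹ w ∘ ι` along the local isometry `ι`,
`helper_stub_floorBridge_gauge`, and the scale algebra), and `0 ≤ R_g Λ − 6Δ_g Λ` off `p` (`Ric_h ≥ 0` traced,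
`R_h = Λ⁻³(R_gΛ − 6Δ_gΛ) ∘ ι`). [cite: ONeill1983, Ch. 3, Prop. 3.59] -/
theorem stub_floorBridge : (∀ (P : Type) [TopologicalSpace P] [T2Space P] [SecondCountableTopology P] [ChartedSpace (EuclideanSpace ℝ (Fin 4)) P] [IsManifold (𝓡 4) ∞ P] [ConnectedSpace P] [T3Space P] [MeasurableSpace P] [BorelSpace P] (h : PseudoRiemannianMetric (𝓡 4) ∞ (EuclideanSpace ℝ (Fin 4)) (TangentSpace (𝓡 4) : P → Type _)) [h.HasLeviCivita] (hh : h.IsRiemannian) (θ : ℝ), (∀ (x : P) (r : NNReal), IsCompact {y : P | h.edist hh x y ≤ r}) → (∀ (x : P) (X : TangentSpace (𝓡 4) x), 0 ≤ h.ricci x X X) → 0 < θ → (∀ x : P, Tendsto (fun r : ℝ ↦ ((riemannianMeasure (h.toContMDiffRiemannianMetric hh)) {y : P | h.edist hh x y ≤ ENNReal.ofReal r}).toReal / (Real.pi ^ 2 / 2 * r ^ 4)) atTop (𝓝 θ)) → ∀ u : P → ℝ, ContMDiff (𝓡 4) 𝓘(ℝ, ℝ) ∞ u → HasCompactSupport u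 → ∫ x, (u x) ^ 2 ∂(riemannianMeasure (h.toContMDiffRiemannianMetric hh)) = 1 → ∀ τ : ℝ, 0 < τ → ∫ x, (u x) ^ 2 * Real.log ((u x) ^ 2) ∂(riemannianMeasure (h.toContMDiffRiemannianMetric hh)) ≤ 4 * τ * ∫ x, h.gradSq u x ∂(riemannianMeasure (h.toContMDiffRiemannianMetric hh)) - Real.log θ - 2 * Real.log (4 * Real.pi * τ) - 4) → ∀ (M : Type) [TopologicalSpace M] [T2Space M] [SecondCountableTopology M] [ChartedSpace (EuclideanSpace ℝ (Fin 4)) M] [IsManifold (𝓡 4) ∞ M] [CompactSpace M] [T3Space M] [MeasurableSpace M] [BorelSpace M] (g : PseudoRiemannianMetric (𝓡 4) ∞ (EuclideanSpace ℝ (Fin 4)) (TangentSpace (𝓡 4) : M → Type _)) [g.HasLeviCivita] (hg : g.IsRiemannian) (p : M) (Λ : M → ℝ) (c : ℝ) (P : Type) [TopologicalSpace P] [T2Space P] [SecondCountableTopology P] [ChartedSpace (EuclideanSpace ℝ (Fin 4)) P] [IsManifold (𝓡 4) ∞ P] [ConnectedSpace P] [NoncompactSpace P] [T3Space P] [MeasurableSpace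 P] [BorelSpace P] (h : PseudoRiemannianMetric (𝓡 4) ∞ (EuclideanSpace ℝ (Fin 4)) (TangentSpace (𝓡 4) : P → Type _)) [h.HasLeviCivita] (hh : h.IsRiemannian) (ι : P → M) (σ : M → P), ContMDiffOn (𝓡 4) 𝓘(ℝ, ℝ) ∞ Λ {p}ᶜ → (∀ x, x ≠ p → 0 < Λ x) → 0 < c → (ContMDiff (𝓡 4) (𝓡 4) ∞ ι ∧ Injective ι ∧ (∀ q : P, Injective (mfderiv (𝓡 4) (𝓡 4) ι q)) ∧ range ι = {p}ᶜ ∧ ContMDiffOn (𝓡 4) (𝓡 4) ∞ σ {p}ᶜ ∧ (∀ q : P, σ (ι q) = q) ∧ (∀ x : M, x ≠ p → ι (σ x) = x) ∧ ∀ (q : P) (v w : TangentSpace (𝓡 4) q), h.val q v w = Λ (ι q) ^ 2 * g.val (ι q) (mfderiv (𝓡 4) (𝓡 4) ι q v) (mfderiv (𝓡 4) (𝓡 4) ι q w)) → ((∀ (x : P) (r : NNReal), IsCompact {y : P | h.edist hh x y ≤ r}) ∧ (∀ (x : P) (X : TangentSpace (𝓡 4) x), 0 ≤ h.ricci x X X)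 ∧ ∀ x : P, Tendsto (fun r : ℝ ↦ ((riemannianMeasure (h.toContMDiffRiemannianMetric hh)) {y : P | h.edist hh x y ≤ ENNReal.ofReal r}).toReal / (Real.pi ^ 2 / 2 * r ^ 4)) atTop (𝓝 (c ^ 3))) → (∀ τ : ℝ, 0 < τ → ∀ w : M → ℝ, ContMDiff (𝓡 4) 𝓘(ℝ, ℝ) ∞ w → w =ᶠ[𝓝 p] 0 → ∫ x, (4 * Real.pi * τ) ^ (-(4 : ℝ) / 2) * (w x) ^ 2 * (Λ x) ^ 4 ∂(riemannianMeasure (g.toContMDiffRiemannianMetric hg)) = 1 → 3 * Real.log c ≤ ∫ x, (4 * τ * ((Λ x)⁻¹ ^ 2 * g.gradSq w x) - (w x) ^ 2 * Real.log ((w x) ^ 2) - 4 * (w x) ^ 2) * ((4 * Real.pi * τ) ^ (-(4 : ℝ) / 2) * (Λ x) ^ 4) ∂(riemannianMeasure (g.toContMDiffRiemannianMetric hg))) ∧ ∀ x, x ≠ p → 0 ≤ g.scalarCurvature x * Λ x - 6 * g.dalembertian Λ x := by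
  intro hBKT M _ _ _ _ _ _ _ _ _ g _ hg p Λ c P _ _ _ _ _ _ _ _ _ _ h _ hh ι σ hΛs hΛpos hc hlink hgeom
  obtain ⟨hι, hinj, hι', hrange, hσ, hσι, hισ, hval⟩ := hlink
  obtain ⟨hcomplete, hRic, hAVR⟩ := hgeom
  refine ⟨fun τ hτ w hw hwp hnorm ↦ ?_, fun x hx ↦ ?_⟩
  · /- (A) the floor on `M` -/
    set μg : Measure M := riemannianMeasure (g.toContMDiffRiemannianMetric hg) with hμg
    set μh : Measure P := riemannianMeasure (h.toContMDiffRiemannianMetric hh) with hμh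
    set A : ℝ := (4 * Real.pi * τ) ^ (-(4 : ℝ) / 2) with hA
    -- the frozen gauge near `K = tsupport w`
    have hpK : p ∉ tsupport w := notMem_tsupport_iff_eventuallyEq.2 hwp
    obtain ⟨Φ, hΦ, hΦpos, U, hU, hKU, -, hΦΛ⟩ :=
      exists_gauge hΛs hΛpos (isClosed_tsupport w) hpK
    obtain ⟨hT, hG, -⟩ := helper_stub_floorBridge_gauge M P g hg p h hh ι σ Λ Φ U hι hinj hι' hrange
      hσ hσι hισ hval hΦ hΦpos hU hΦΛ
    -- `w` and `|∇w|²` vanish off `U ⊇ tsupport w`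
    have hwU : ∀ x ∉ U, w x = 0 := fun x hx ↦
      image_eq_zero_of_notMem_tsupport fun hK ↦ hx (hKU hK)
    have hgradU : ∀ x ∉ U, g.gradSq w x = 0 := by
      intro x hx
      have hev : w =ᶠ[𝓝 x] fun _ ↦ (0 : ℝ) :=
        notMem_tsupport_iff_eventuallyEq.1 fun hK ↦ hx (hKU hK)
      rw [show g.gradSq w x = g.gradSq (fun _ ↦ (0 : ℝ)) x by
        simp only [PseudoRiemannianMetric.gradSq, mvfderiv_congr_of_eventuallyEq hev]]
      exact g.gradSq_const 0 x
    -- the scale constants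
    have hπτ : 0 < 4 * Real.pi * τ := by positivity
    have hApos : 0 < A := Real.rpow_pos_of_pos hπτ _
    have hlogA : Real.log A = -2 * Real.log (4 * Real.pi * τ) := by
      rw [hA, Real.log_rpow hπτ]
      ring
    set s : ℝ := Real.sqrt A with hs
    have hs2 : s ^ 2 = A := Real.sq_sqrt hApos.le
    -- the test function `u = √A · w ∘ ι` on `P`
    set u : P → ℝ := fun q ↦ s * w (ι q) with hu
    have hvs : ContMDiff (𝓡 4) 𝓘(ℝ, ℝ) ∞ fun q ↦ w (ι q) := hw.comp hι
    have hvc : HasCompactSupport fun q ↦ w (ι q) :=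
      hasCompactSupport_comp hwp hι.continuous hσ.continuousOn hσι hισ
    have hus : ContMDiff (𝓡 4) 𝓘(ℝ, ℝ) ∞ u := contMDiff_const.mul hvs
    have huc : HasCompactSupport u := hvc.mul_left
    -- the gradient of `w ∘ ι` on all of `P`
    have hgradP : ∀ q, h.gradSq (fun q ↦ w (ι q)) q = (Φ (ι q))⁻¹ ^ 2 * g.gradSq w (ι q) := by
      intro q
      by_cases hq : ι q ∈ U
      · exact hG w hw q hq
      · have hw0 : w =ᶠ[𝓝 (ι q)] fun _ ↦ (0 : ℝ) :=
          notMem_tsupport_iff_eventuallyEq.1 fun hK ↦ hq (hKU hK)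
        have hv0 : (fun q ↦ w (ι q)) =ᶠ[𝓝 q] fun _ ↦ (0 : ℝ) :=
          hw0.comp_tendsto (hι.continuous.tendsto q)
        rw [show h.gradSq (fun q ↦ w (ι q)) q = h.gradSq (fun _ ↦ (0 : ℝ)) q by
          simp only [PseudoRiemannianMetric.gradSq, mvfderiv_congr_of_eventuallyEq hv0],
          h.gradSq_const 0 q, hgradU _ hq, mul_zero]
    -- the three integrals on `M`
    set I₂ : ℝ := ∫ x, w x ^ 2 * Φ x ^ 4 ∂μg with hI₂
    set Ilog : ℝ := ∫ x, w x ^ 2 * Real.log (w x ^ 2) * Φ x ^ 4 ∂μg with hIlog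
    set Igrad : ℝ := ∫ x, (Φ x)⁻¹ ^ 2 * g.gradSq w x * Φ x ^ 4 ∂μg with hIgrad
    have hc1 : Continuous fun x ↦ w x ^ 2 * Φ x ^ 4 :=
      (hw.continuous.pow 2).mul (hΦ.continuous.pow 4)
    have hc2 : Continuous fun x ↦ w x ^ 2 * Real.log (w x ^ 2) * Φ x ^ 4 :=
      (Real.continuous_mul_log.comp (hw.continuous.pow 2)).mul (hΦ.continuous.pow 4)
    have hc3 : Continuous fun x ↦ (Φ x)⁻¹ ^ 2 * g.gradSq w x * Φ x ^ 4 :=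
      (((hΦ.continuous.inv₀ fun x ↦ (hΦpos x).ne').pow 2).mul
        (contMDiff_gradSq g hw).continuous).mul (hΦ.continuous.pow 4)
    have hi1 : Integrable (fun x ↦ w x ^ 2 * Φ x ^ 4) μg :=
      integrable_of_continuous (g.toContMDiffRiemannianMetric hg) hc1
    have hi2 : Integrable (fun x ↦ w x ^ 2 * Real.log (w x ^ 2) * Φ x ^ 4) μg :=
      integrable_of_continuous (g.toContMDiffRiemannianMetric hg) hc2
    have hi3 : Integrable (fun x ↦ (Φ x)⁻¹ ^ 2 * g.gradSq w x * Φ x ^ 4) μg :=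
      integrable_of_continuous (g.toContMDiffRiemannianMetric hg) hc3
    -- transport of `∫ u²`, `∫ u² log u²`, `∫ |∇u|²`
    have hIu2 : ∫ q, u q ^ 2 ∂μh = A * I₂ := by
      have hpt : ∀ q, u q ^ 2 = A * w (ι q) ^ 2 := fun q ↦ by
        simp only [hu]
        rw [mul_pow, hs2]
      simp_rw [hpt]
      rw [integral_const_mul, hT (fun x ↦ w x ^ 2) fun x hx ↦ by simp [hwU x hx]]
    have hIulog : ∫ q, u q ^ 2 * Real.log (u q ^ 2) ∂μh = A * Real.log A * I₂ + A * Ilog := by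
      have hpt : ∀ q, u q ^ 2 * Real.log (u q ^ 2) =
          A * Real.log A * w (ι q) ^ 2 + A * (w (ι q) ^ 2 * Real.log (w (ι q) ^ 2)) := by
        intro q
        simp only [hu]
        rw [mul_pow, hs2]
        by_cases h0 : w (ι q) = 0
        · simp [h0]
        · rw [Real.log_mul hApos.ne' (pow_ne_zero 2 h0)]
          ring
      simp_rw [hpt]
      rw [hT (fun x ↦ A * Real.log A * w x ^ 2 + A * (w x ^ 2 * Real.log (w x ^ 2)))
        fun x hx ↦ by simp [hwU x hx]]
      have hpt' : ∀ x, (A * Real.log A * w x ^ 2 + A * (w x ^ 2 * Real.log (w x ^ 2))) * Φ x ^ 4 =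
          A * Real.log A * (w x ^ 2 * Φ x ^ 4) +
            A * (w x ^ 2 * Real.log (w x ^ 2) * Φ x ^ 4) := fun x ↦ by ring
      simp_rw [hpt']
      rw [integral_add (hi1.const_mul _) (hi2.const_mul _), integral_const_mul, integral_const_mul]
    have hIugrad : ∫ q, h.gradSq u q ∂μh = A * Igrad := by
      have hpt : ∀ q, h.gradSq u q = A * ((Φ (ι q))⁻¹ ^ 2 * g.gradSq w (ι q)) := by
        intro q
        rw [hu, h.gradSq_const_mul (fun q ↦ w (ι q)) s q, hs2, hgradP q]
      simp_rw [hpt]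
      rw [integral_const_mul, hT (fun x ↦ (Φ x)⁻¹ ^ 2 * g.gradSq w x) fun x hx ↦ by
        simp [hgradU x hx]]
    -- the normalisation `A I₂ = 1`
    have hnorm' : A * I₂ = 1 := by
      rw [← hnorm, hI₂, ← integral_const_mul]
      refine integral_congr_ae (ae_of_all _ fun x ↦ ?_)
      change A * (w x ^ 2 * Φ x ^ 4) = A * w x ^ 2 * Λ x ^ 4
      by_cases hx : x ∈ U
      · rw [← hΦΛ x hx]
        ring
      · simp [hwU x hx]
    have hIu2' : ∫ q, u q ^ 2 ∂μh = 1 := hIu2.trans hnorm'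
    -- BKT on `(P, h)` for `u`
    have hbkt := hBKT P h hh (c ^ 3) hcomplete hRic (pow_pos hc 3) hAVR u hus huc hIu2' τ hτ
    rw [hIulog, hIugrad] at hbkt
    -- the goal in terms of `I₂`, `Ilog`, `Igrad`
    have hgoal : ∫ x, (4 * τ * ((Λ x)⁻¹ ^ 2 * g.gradSq w x) - w x ^ 2 * Real.log (w x ^ 2)
        - 4 * w x ^ 2) * (A * Λ x ^ 4) ∂μg = A * (4 * τ) * Igrad - A * Ilog - 4 * A * I₂ := by
      have hpt : ∀ x, (4 * τ * ((Λ x)⁻¹ ^ 2 * g.gradSq w x) - w x ^ 2 * Real.log (w x ^ 2)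
          - 4 * w x ^ 2) * (A * Λ x ^ 4) =
          A * (4 * τ) * ((Φ x)⁻¹ ^ 2 * g.gradSq w x * Φ x ^ 4)
            - A * (w x ^ 2 * Real.log (w x ^ 2) * Φ x ^ 4) - 4 * A * (w x ^ 2 * Φ x ^ 4) := by
        intro x
        by_cases hx : x ∈ U
        · rw [← hΦΛ x hx]
          ring
        · simp [hwU x hx, hgradU x hx]
      simp_rw [hpt]
      have hi3' : Integrable (fun x ↦ A * (4 * τ) * ((Φ x)⁻¹ ^ 2 * g.gradSq w x * Φ x ^ 4)) μg :=
        hi3.const_mul _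
      have hi2' : Integrable (fun x ↦ A * (w x ^ 2 * Real.log (w x ^ 2) * Φ x ^ 4)) μg :=
        hi2.const_mul _
      have hi1' : Integrable (fun x ↦ 4 * A * (w x ^ 2 * Φ x ^ 4)) μg := hi1.const_mul _
      have e1 : ∫ x, A * (4 * τ) * ((Φ x)⁻¹ ^ 2 * g.gradSq w x * Φ x ^ 4)
          - A * (w x ^ 2 * Real.log (w x ^ 2) * Φ x ^ 4) - 4 * A * (w x ^ 2 * Φ x ^ 4) ∂μg =
          ∫ x, A * (4 * τ) * ((Φ x)⁻¹ ^ 2 * g.gradSq w x * Φ x ^ 4)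
            - A * (w x ^ 2 * Real.log (w x ^ 2) * Φ x ^ 4) ∂μg
          - ∫ x, 4 * A * (w x ^ 2 * Φ x ^ 4) ∂μg := integral_sub (hi3'.sub hi2') hi1'
      have e2 : ∫ x, A * (4 * τ) * ((Φ x)⁻¹ ^ 2 * g.gradSq w x * Φ x ^ 4)
          - A * (w x ^ 2 * Real.log (w x ^ 2) * Φ x ^ 4) ∂μg =
          ∫ x, A * (4 * τ) * ((Φ x)⁻¹ ^ 2 * g.gradSq w x * Φ x ^ 4) ∂μg
          - ∫ x, A * (w x ^ 2 * Real.log (w x ^ 2) * Φ x ^ 4) ∂μg := integral_sub hi3' hi2'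
      rw [e1, e2, integral_const_mul, integral_const_mul, integral_const_mul]
    rw [hgoal]
    have hkey : A * Real.log A * I₂ = Real.log A := by
      calc A * Real.log A * I₂ = Real.log A * (A * I₂) := by ring
        _ = Real.log A := by rw [hnorm', mul_one]
    have hlog3 : Real.log (c ^ 3) = 3 * Real.log c := by
      rw [Real.log_pow]
      norm_num
    rw [hlog3] at hbkt
    linarith [hbkt, hkey, hlogA, hnorm']
  · /- (B) `R_{Λ²g} ≥ 0` off `p` -/
    obtain ⟨Φ, hΦ, hΦpos, U, hU, hxU, -, hΦΛ⟩ :=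
      exists_gauge hΛs hΛpos (isClosed_singleton (x := x)) (fun hpx ↦ hx (mem_singleton_iff.1 hpx).symm)
    obtain ⟨-, -, hS⟩ := helper_stub_floorBridge_gauge M P g hg p h hh ι σ Λ Φ U hι hinj hι' hrange
      hσ hσι hισ hval hΦ hΦpos hU hΦΛ
    have hxU' : x ∈ U := hxU rfl
    have hιx : ι (σ x) ∈ U := by rw [hισ x hx]; exact hxU'
    have hR := hS (σ x) hιx
    rw [hισ x hx] at hR
    have hR0 : 0 ≤ h.scalarCurvature (σ x) := by
      have h4 := EntropyVolume.scalarCurvature_ge_four_mul_of_ricci_ge h hh (c := 0) (x := σ x)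
        fun v ↦ by simpa using hRic (σ x) v
      linarith
    rw [hR, hΦΛ x hxU', g.dalembertian_congr_of_eventuallyEq
      (Filter.eventuallyEq_of_mem (hU.mem_nhds hxU') hΦΛ)] at hR0
    exact (mul_nonneg_iff_of_pos_left (inv_pos.2 (pow_pos (hΛpos x hx) 3))).1 hR0

end Summit.SmoothPoincare4.SmoothPoincare4.Theorems

end
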